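import Mathlib.Tactic
import HarnessLib
import HarnessLib.Audit.Tags
import Summits.CriticalPhenomena.PercolationContinuityZ3.Theorems.PercNearOneGluingNoHeavyLowerTailSahiAntichainMidRange
import Summits.CriticalPhenomena.PercolationContinuityZ3.Theorems.PercNearOneGluingNoHeavyLowerTailSahiAntichainThreeCoFour

/-!
# Antichains, meets plus joins: V5 from the two remaining finite lemmas L3 and L4⁺

Support file (seat `prim-masterthm-p1`, gen 37; `--supports stmt-CriticalPhenomena-4575`).  No `sorry`, no new definitions, standard
axioms.  Memo `run/shared/lean/prim/prim-masterthm/FROM-prim-masterthm-p1-g37-LINEAR-REDUCTION.md`.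

SETTING: `…SahiAntichainMidRange` proved `two_mul_card_le_of_L3_L4_E3 : L3 → L4⁺ → E3c → V5`; `…ThreeCoFour` proved E3c.

NEW HERE ([this work], gen 37): **`two_mul_card_le_of_L3_L4 : L3 → L4 → V5`** (and the linear form for `#P ≥ 7`, and V1), with the
six-side lemma in its WEAK form (`f ≤ 11`, one extra case split at `4 + 6` in the mid-range table: `antichainMidRange_of_L3_L4`), where
* «L3»  `∀ Q, IsAntichain Q → #Q = 5 → 10 ≤ #meets Q + #joins Q` (kernel: `≥ 9`, `nine_le_of_card_eq_five`; exhaustive `2^6` and annealing on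
  7–10 points: minimum 10, attained by the `C([4],2)` blow-ups minus a member);
* «L4»  `∀ P r, IsAntichain P → #(above P r) = 6 → (below P r).Nonempty → #meets (above) + #joins (above) ≤ 11 → 4 ≤ newLabels P r`
  (data: a six-member antichain has ten labels — a `C([4],2)` blow-up — or at least thirteen; a `C([4],2)`-type side creates at least four
  new labels, attained against an aligned four-member sunflower).
So the conjecture V5 of gens 34–36 (every antichain has `#meets + #joins ≥ 2 #P − 2`), and with it `f ≥ 2 #P` for `#P ≥ 7`, now rest on
two explicit finite statements about five- and six-member families.
HONEST FRAMING: L3, L4 and V5 remain OPEN. [this work]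
-/

namespace Summit.CriticalPhenomena.PercolationContinuityZ3.Theorems.SahiColouredDaykin

open Finset

variable {α : Type*} [DecidableEq α]

/-- The dual weak six-side lemma (small side below), by complementation. [this work] -/
theorem sixSide_below_of_above'
    (hL4 : ∀ (P : Finset (Finset α)) (r : α), IsAntichain (· ⊆ ·) (P : Set (Finset α)) → #(above P r) = 6 →
      (below P r).Nonempty → #(meets (above P r)) + #(joins (above P r)) ≤ 11 → 4 ≤ newLabels P r) :
    ∀ (P : Finset (Finset α)) (r : α), IsAntichain (· ⊆ ·) (P : Set (Finset α)) → #(below P r) = 6 →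
      (above P r).Nonempty → #(meets (below P r)) + #(joins (below P r)) ≤ 11 → 4 ≤ newLabels P r := by
  intro P r hanti h6 hA hf
  set F := insert r (P.sup id) with hF
  have hP : ∀ a ∈ P, a ⊆ F := subset_insert_sup P r
  have hPB : ∀ a ∈ below P r, a ⊆ F := fun a ha => hP a (below_subset P r ha)
  have hr : r ∈ F := mem_insert_self _ _
  rw [← newLabels_image_compl hP hr]
  refine hL4 (P.image (F \ ·)) r (isAntichain_image_compl hanti hP) (by rw [card_above_image_compl hP hr]; exact h6)
    (by rw [below_image_compl (P := P) hr]; exact hA.image _) ?_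
  rw [above_image_compl (P := P) hr, card_meets_add_card_joins_image_compl hPB]
  exact hf

/-- **`AntichainMidRange` from L3 and the WEAK six-side lemma L4** (`f ≤ 11 → 4 ≤ newLabels`; a six-member side with twelve or more labels needs
no new label at all).  Same case table as `antichainMidRange_of`, with E3c discharged by `…ThreeCoFour` and one extra split at `4 + 6`. [this work] -/
theorem antichainMidRange_of_L3_L4
    (hL3 : ∀ Q : Finset (Finset α), IsAntichain (· ⊆ ·) (Q : Set (Finset α)) → #Q = 5 → 10 ≤ #(meets Q) + #(joins Q))
    (hL4 : ∀ (P : Finset (Finset α)) (r : α), IsAntichain (· ⊆ ·) (P : Set (Finset α)) → #(above P r) = 6 →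
      (below P r).Nonempty → #(meets (above P r)) + #(joins (above P r)) ≤ 11 → 4 ≤ newLabels P r)
    (hL4' : ∀ (P : Finset (Finset α)) (r : α), IsAntichain (· ⊆ ·) (P : Set (Finset α)) → #(below P r) = 6 →
      (above P r).Nonempty → #(meets (below P r)) + #(joins (below P r)) ≤ 11 → 4 ≤ newLabels P r)
    : AntichainMidRange α := by
  have hE3c : ∀ (P : Finset (Finset α)) (r : α), IsAntichain (· ⊆ ·) (P : Set (Finset α)) → #(above P r) = 3 → #(below P r) = 4 →
      #(meets (above P r)) + #(joins (above P r)) ≤ 4 → #(joins (below P r)) ≤ 1 → 3 ≤ newLabels P r :=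
    fun P r hanti h3 h4 hf hJ => three_le_newLabels_of_three_le_four_cofour P r hanti h3 h4 hf hJ
  have hE3c' := threeFour_below_of_above hE3c
  suffices H : ∀ n, 7 ≤ n → n ≤ 12 → ∀ P : Finset (Finset α), #P = n → IsAntichain (· ⊆ ·) (P : Set (Finset α)) →
      2 * #P ≤ #(meets P) + #(joins P) from fun P hP h7 h12 => H _ h7 h12 P rfl hP
  intro n
  induction n using Nat.strong_induction_on with
  | _ n ih =>
    intro h7 h12 P hPn hanti
    obtain ⟨r, hr⟩ := effPoints_nonempty (by omega : 2 ≤ #P)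
    obtain ⟨hA, hB⟩ := mem_effPoints_iff.1 hr
    have hcard := card_above_add_card_below P r
    have hApos : 0 < #(above P r) := card_pos.2 hA
    have hBpos : 0 < #(below P r) := card_pos.2 hB
    have hsplit := card_meets_add_card_joins_split P r
    have hantiA := isAntichain_above hanti r
    have hantiB := isAntichain_below hanti r
    -- generic lower bounds for the two sides: V5 for at most eight members, and the induction hypothesis above seven
    have vA : #(above P r) ≤ 8 → 2 * #(above P r) ≤ #(meets (above P r)) + #(joins (above P r)) + 2 :=
      fun h => two_mul_card_le_of_card_le_eight _ hantiA h
    have vB : #(below P r) ≤ 8 → 2 * #(below P r) ≤ #(meets (below P r)) + #(joins (below P r)) + 2 :=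
      fun h => two_mul_card_le_of_card_le_eight _ hantiB h
    have iA : 7 ≤ #(above P r) → 2 * #(above P r) ≤ #(meets (above P r)) + #(joins (above P r)) :=
      fun h => ih _ (by omega) h (by omega) _ rfl hantiA
    have iB : 7 ≤ #(below P r) → 2 * #(below P r) ≤ #(meets (below P r)) + #(joins (below P r)) :=
      fun h => ih _ (by omega) h (by omega) _ rfl hantiB
    -- small-side facts
    have sA2 : #(above P r) ≤ 2 → 2 ≤ newLabels P r := fun h => two_le_newLabels_of_min_le_two hanti hA hB (Or.inl h)
    have sB2 : #(below P r) ≤ 2 → 2 ≤ newLabels P r := fun h => two_le_newLabels_of_min_le_two hanti hA hB (Or.inr h)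
    have uA3 : #(above P r) = 3 → 1 ≤ newLabels P r := fun h => newLabels_pos_of_card_above_eq_three hanti h hB
    have uB3 : #(below P r) = 3 → 1 ≤ newLabels P r := fun h => newLabels_pos_of_card_below_eq_three hanti h hA
    have sA3 : #(above P r) = 3 → #(meets (above P r)) + #(joins (above P r)) ≤ 4 → 2 ≤ newLabels P r :=
      fun h hf => two_le_newLabels_of_above_three_le_four hanti h hB hf
    have sB3 : #(below P r) = 3 → #(meets (below P r)) + #(joins (below P r)) ≤ 4 → 2 ≤ newLabels P r :=
      fun h hf => two_le_newLabels_of_below_three_le_four hanti h hA hf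
    have fA4 : #(above P r) = 4 → 7 ≤ #(meets (above P r)) + #(joins (above P r)) := fun h => seven_le_of_card_eq_four hantiA h
    have fB4 : #(below P r) = 4 → 7 ≤ #(meets (below P r)) + #(joins (below P r)) := fun h => seven_le_of_card_eq_four hantiB h
    have sA4 : #(above P r) = 4 → #(meets (above P r)) + #(joins (above P r)) ≤ 7 → 2 ≤ newLabels P r :=
      fun h hf => two_le_newLabels_of_above_four_le_seven hanti h hB hf
    have sB4 : #(below P r) = 4 → #(meets (below P r)) + #(joins (below P r)) ≤ 7 → 2 ≤ newLabels P r :=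
      fun h hf => two_le_newLabels_of_below_four_le_seven hanti h hA hf
    have fA5 : #(above P r) = 5 → 10 ≤ #(meets (above P r)) + #(joins (above P r)) := fun h => hL3 _ hantiA h
    have fB5 : #(below P r) = 5 → 10 ≤ #(meets (below P r)) + #(joins (below P r)) := fun h => hL3 _ hantiB h
    have sA6 : #(above P r) = 6 → #(meets (above P r)) + #(joins (above P r)) ≤ 11 → 4 ≤ newLabels P r :=
      fun h hf => hL4 P r hanti h hB hf
    have sB6 : #(below P r) = 6 → #(meets (below P r)) + #(joins (below P r)) ≤ 11 → 4 ≤ newLabels P r :=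
      fun h hf => hL4' P r hanti h hA hf
    have e34 : #(above P r) = 3 → #(below P r) = 4 → #(meets (above P r)) + #(joins (above P r)) ≤ 4 →
        #(meets (below P r)) + #(joins (below P r)) ≤ 7 → 3 ≤ newLabels P r := by
      intro h h' hf hf'
      rcases sunflower_or_cosunflower_of_card_eq_four hantiB h' hf' with ⟨K, hK⟩ | ⟨U, hU⟩
      · exact three_le_newLabels_of_three_sunflower_four h h' hK
      · exact hE3c P r hanti h h' hf (card_joins_le_one_of_cosunflower hU)
    have e43 : #(below P r) = 3 → #(above P r) = 4 → #(meets (below P r)) + #(joins (below P r)) ≤ 4 →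
        #(meets (above P r)) + #(joins (above P r)) ≤ 7 → 3 ≤ newLabels P r := by
      intro h h' hf hf'
      rcases sunflower_or_cosunflower_of_card_eq_four hantiA h' hf' with ⟨K, hK⟩ | ⟨U, hU⟩
      · exact hE3c' P r hanti h h' hf (card_meets_le_one_of_sunflower hK)
      · exact three_le_newLabels_of_cosunflower_four_three h' h hU
    -- the case table
    rw [hPn] at hcard
    by_cases hp1 : #(above P r) ≤ 2
    · have h2 := sA2 hp1
      have := vA (by omega)
      by_cases hq7 : 7 ≤ #(below P r)
      · have := iB hq7; omega
      by_cases hq5 : #(below P r) = 5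
      · have := fB5 hq5; omega
      · have hq6 : #(below P r) = 6 := by omega
        have := vB (by omega)
        by_cases hf : #(meets (below P r)) + #(joins (below P r)) ≤ 11
        · have := sB6 hq6 hf; omega
        · omega
    by_cases hq1 : #(below P r) ≤ 2
    · have h2 := sB2 hq1
      have := vB (by omega)
      by_cases hp7 : 7 ≤ #(above P r)
      · have := iA hp7; omega
      by_cases hp5 : #(above P r) = 5
      · have := fA5 hp5; omega
      · have hp6 : #(above P r) = 6 := by omega
        have := vA (by omega)
        by_cases hf : #(meets (above P r)) + #(joins (above P r)) ≤ 11
        · have := sA6 hp6 hf; omega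
        · omega
    by_cases hp3 : #(above P r) = 3
    · have := vA (by omega)
      have h1 := uA3 hp3
      by_cases hq7 : 7 ≤ #(below P r)
      · have := iB hq7
        by_cases hf : #(meets (above P r)) + #(joins (above P r)) ≤ 4
        · have := sA3 hp3 hf; omega
        · omega
      by_cases hq4 : #(below P r) = 4
      · have h7B := fB4 hq4
        by_cases hf : #(meets (above P r)) + #(joins (above P r)) ≤ 4
        · by_cases hf' : #(meets (below P r)) + #(joins (below P r)) ≤ 7
          · have := e34 hp3 hq4 hf hf'; omega
          · have := sA3 hp3 hf; omega
        · by_cases hf' : #(meets (below P r)) + #(joins (below P r)) ≤ 7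
          · have := sB4 hq4 hf'; omega
          · omega
      by_cases hq5 : #(below P r) = 5
      · have := fB5 hq5
        by_cases hf : #(meets (above P r)) + #(joins (above P r)) ≤ 4
        · have := sA3 hp3 hf; omega
        · omega
      · have hq6 : #(below P r) = 6 := by omega
        have := vB (by omega)
        by_cases hf' : #(meets (below P r)) + #(joins (below P r)) ≤ 11
        · have := sB6 hq6 hf'; omega
        · by_cases hf : #(meets (above P r)) + #(joins (above P r)) ≤ 4
          · have := sA3 hp3 hf; omega
          · omega
    by_cases hq3 : #(below P r) = 3
    · have := vB (by omega)
      have h1 := uB3 hq3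
      by_cases hp7 : 7 ≤ #(above P r)
      · have := iA hp7
        by_cases hf : #(meets (below P r)) + #(joins (below P r)) ≤ 4
        · have := sB3 hq3 hf; omega
        · omega
      by_cases hp4 : #(above P r) = 4
      · have h7A := fA4 hp4
        by_cases hf : #(meets (below P r)) + #(joins (below P r)) ≤ 4
        · by_cases hf' : #(meets (above P r)) + #(joins (above P r)) ≤ 7
          · have := e43 hq3 hp4 hf hf'; omega
          · have := sB3 hq3 hf; omega
        · by_cases hf' : #(meets (above P r)) + #(joins (above P r)) ≤ 7
          · have := sA4 hp4 hf'; omega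
          · omega
      by_cases hp5 : #(above P r) = 5
      · have := fA5 hp5
        by_cases hf : #(meets (below P r)) + #(joins (below P r)) ≤ 4
        · have := sB3 hq3 hf; omega
        · omega
      · have hp6 : #(above P r) = 6 := by omega
        have := vA (by omega)
        by_cases hf' : #(meets (above P r)) + #(joins (above P r)) ≤ 11
        · have := sA6 hp6 hf'; omega
        · by_cases hf : #(meets (below P r)) + #(joins (below P r)) ≤ 4
          · have := sB3 hq3 hf; omega
          · omega
    by_cases hp4 : #(above P r) = 4
    · have h7A := fA4 hp4
      by_cases hq7 : 7 ≤ #(below P r)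
      · have := iB hq7
        by_cases hf : #(meets (above P r)) + #(joins (above P r)) ≤ 7
        · have := sA4 hp4 hf; omega
        · omega
      by_cases hq4 : #(below P r) = 4
      · have h7B := fB4 hq4
        by_cases hf : #(meets (above P r)) + #(joins (above P r)) ≤ 7
        · have := sA4 hp4 hf; omega
        · by_cases hf' : #(meets (below P r)) + #(joins (below P r)) ≤ 7
          · have := sB4 hq4 hf'; omega
          · omega
      by_cases hq5 : #(below P r) = 5
      · have := fB5 hq5
        by_cases hf : #(meets (above P r)) + #(joins (above P r)) ≤ 7
        · have := sA4 hp4 hf; omega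
        · omega
      · have hq6 : #(below P r) = 6 := by omega
        have := vB (by omega)
        by_cases hf' : #(meets (below P r)) + #(joins (below P r)) ≤ 11
        · have := sB6 hq6 hf'; omega
        · by_cases hf : #(meets (above P r)) + #(joins (above P r)) ≤ 7
          · have := sA4 hp4 hf; omega
          · omega
    by_cases hq4 : #(below P r) = 4
    · have h7B := fB4 hq4
      by_cases hp7 : 7 ≤ #(above P r)
      · have := iA hp7
        by_cases hf : #(meets (below P r)) + #(joins (below P r)) ≤ 7
        · have := sB4 hq4 hf; omega
        · omega
      by_cases hp5 : #(above P r) = 5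
      · have := fA5 hp5
        by_cases hf : #(meets (below P r)) + #(joins (below P r)) ≤ 7
        · have := sB4 hq4 hf; omega
        · omega
      · have hp6 : #(above P r) = 6 := by omega
        have := vA (by omega)
        by_cases hf' : #(meets (above P r)) + #(joins (above P r)) ≤ 11
        · have := sA6 hp6 hf'; omega
        · by_cases hf : #(meets (below P r)) + #(joins (below P r)) ≤ 7
          · have := sB4 hq4 hf; omega
          · omega
    -- both sides have five or more members
    by_cases hp5 : #(above P r) = 5
    · have := fA5 hp5
      by_cases hq7 : 7 ≤ #(below P r)
      · have := iB hq7; omega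
      by_cases hq5 : #(below P r) = 5
      · have := fB5 hq5; omega
      · have hq6 : #(below P r) = 6 := by omega
        have := vB (by omega)
        by_cases hf' : #(meets (below P r)) + #(joins (below P r)) ≤ 11
        · have := sB6 hq6 hf'; omega
        · omega
    by_cases hq5 : #(below P r) = 5
    · have := fB5 hq5
      by_cases hp7 : 7 ≤ #(above P r)
      · have := iA hp7; omega
      · have hp6 : #(above P r) = 6 := by omega
        have := vA (by omega)
        by_cases hf' : #(meets (above P r)) + #(joins (above P r)) ≤ 11
        · have := sA6 hp6 hf'; omega
        · omega
    -- six or more on both sides: only `6 + 6` fits below thirteen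
    have hp6 : #(above P r) = 6 := by omega
    have hq6 : #(below P r) = 6 := by omega
    have := vA (by omega)
    have := vB (by omega)
    by_cases hf : #(meets (above P r)) + #(joins (above P r)) ≤ 11
    · have := sA6 hp6 hf; omega
    by_cases hf' : #(meets (below P r)) + #(joins (below P r)) ≤ 11
    · have := sB6 hq6 hf'; omega
    · omega


/-- **V5 from L3 and the weak L4.**  If every five-member antichain has at least ten labels (L3) and every six-member side with at most
eleven labels of its own creates at least four new labels (L4; by the data only the `C([4],2)` blow-ups, with exactly ten labels, occur),
then every antichain satisfies `2 #P ≤ #meets P + #joins P + 2`. [this work] -/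
theorem two_mul_card_le_of_L3_L4
    (hL3 : ∀ Q : Finset (Finset α), IsAntichain (· ⊆ ·) (Q : Set (Finset α)) → #Q = 5 → 10 ≤ #(meets Q) + #(joins Q))
    (hL4 : ∀ (P : Finset (Finset α)) (r : α), IsAntichain (· ⊆ ·) (P : Set (Finset α)) → #(above P r) = 6 →
      (below P r).Nonempty → #(meets (above P r)) + #(joins (above P r)) ≤ 11 → 4 ≤ newLabels P r) :
    ∀ P : Finset (Finset α), IsAntichain (· ⊆ ·) (P : Set (Finset α)) → 2 * #P ≤ #(meets P) + #(joins P) + 2 :=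
  two_mul_card_le_of_linear (antichainMidRange_of_L3_L4 hL3 hL4 (sixSide_below_of_above' hL4))
    (antichainSmallSide_of hL3 fun P r hanti h6 hB hf => le_trans (by norm_num) (hL4 P r hanti h6 hB hf))

/-- **The linear form from L3 and the weak L4**: `7 ≤ #P → 2 #P ≤ #meets P + #joins P`. [this work] -/
theorem two_mul_card_le_linear_of_L3_L4
    (hL3 : ∀ Q : Finset (Finset α), IsAntichain (· ⊆ ·) (Q : Set (Finset α)) → #Q = 5 → 10 ≤ #(meets Q) + #(joins Q))
    (hL4 : ∀ (P : Finset (Finset α)) (r : α), IsAntichain (· ⊆ ·) (P : Set (Finset α)) → #(above P r) = 6 →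
      (below P r).Nonempty → #(meets (above P r)) + #(joins (above P r)) ≤ 11 → 4 ≤ newLabels P r) :
    ∀ P : Finset (Finset α), IsAntichain (· ⊆ ·) (P : Set (Finset α)) → 7 ≤ #P → 2 * #P ≤ #(meets P) + #(joins P) :=
  two_mul_card_le_linear (antichainMidRange_of_L3_L4 hL3 hL4 (sixSide_below_of_above' hL4))
    (antichainSmallSide_of hL3 fun P r hanti h6 hB hf => le_trans (by norm_num) (hL4 P r hanti h6 hB hf))

/-- **V1 from L3 and the weak L4**: `#P ≤ #meets P + 1` or `#P ≤ #joins P + 1` for every antichain. [this work] -/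
theorem card_le_or_card_le_of_L3_L4
    (hL3 : ∀ Q : Finset (Finset α), IsAntichain (· ⊆ ·) (Q : Set (Finset α)) → #Q = 5 → 10 ≤ #(meets Q) + #(joins Q))
    (hL4 : ∀ (P : Finset (Finset α)) (r : α), IsAntichain (· ⊆ ·) (P : Set (Finset α)) → #(above P r) = 6 →
      (below P r).Nonempty → #(meets (above P r)) + #(joins (above P r)) ≤ 11 → 4 ≤ newLabels P r)
    (P : Finset (Finset α)) (hanti : IsAntichain (· ⊆ ·) (P : Set (Finset α))) : #P ≤ #(meets P) + 1 ∨ #P ≤ #(joins P) + 1 :=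
  card_le_or_card_le_of_two_mul_card_le (two_mul_card_le_of_L3_L4 hL3 hL4 P hanti)

/-- For the record, the strong-L4 version with E3c discharged: `L3 → L4⁺ (f ≤ 12) → V5`. [this work] -/
theorem two_mul_card_le_of_L3_L4plus
    (hL3 : ∀ Q : Finset (Finset α), IsAntichain (· ⊆ ·) (Q : Set (Finset α)) → #Q = 5 → 10 ≤ #(meets Q) + #(joins Q))
    (hL4 : ∀ (P : Finset (Finset α)) (r : α), IsAntichain (· ⊆ ·) (P : Set (Finset α)) → #(above P r) = 6 →
      (below P r).Nonempty → #(meets (above P r)) + #(joins (above P r)) ≤ 12 → 4 ≤ newLabels P r) :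
    ∀ P : Finset (Finset α), IsAntichain (· ⊆ ·) (P : Set (Finset α)) → 2 * #P ≤ #(meets P) + #(joins P) + 2 :=
  two_mul_card_le_of_L3_L4_E3 hL3 hL4 (fun P r hanti h3 h4 hf hJ => three_le_newLabels_of_three_le_four_cofour P r hanti h3 h4 hf hJ)

end Summit.CriticalPhenomena.PercolationContinuityZ3.Theorems.SahiColouredDaykin
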